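import Summits.HubbardSuperconductivity.HubbardSuperconductivity.Theses.ParentFirstSMA
import HarnessLib

/-!
# Crux `DiluteDWavePairsCondense` (stmt-HubbardSuperconductivity-10771) is SUMMIT-STRENGTH: the strong-coupling-window sandwich

Helper for route `ParentFirstSMA` (`--supports stmt-HubbardSuperconductivity-10771`), written by the
redirect crux-strategist `cstrat-stmt-HubbardSuperconductivity-10771-r1` for the pre-birth / retro
tribunal (docs/architecture/tribunal.md §5, T1 route (a): "dominating hypothesis `H ⇒ C` landed, with
`H ⇒ S` alone"). The crux is the BEC bridge

  `C := ∀ U ∈ [12, 24], (a) uniform half-filled charge gap → (b) uniform two-hole binding →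
        (c) d_{x²-y²} coherence of the bound pair → ∃ δ ∈ (0, 1/2), <summit matrix at (U, δ)>`,

whose conclusion is, word for word, the body of the summit `HubbardSuperconductivity =
Literature.Hubbard.DWaveSuperconductivityHubbard` after its quantifier `∃ U > 0`. Let

  `H := ∀ U ∈ [12, 24], ∃ δ ∈ (0, 1/2), <summit matrix at (U, δ)>`

("`d`-wave superconductivity of the pure `t' = 0` model at EVERY coupling of the strong-coupling window
`U/t ∈ [12, 24]`, i.e. `J = 4t²/U ∈ [t/6, t/3]`" — the summit asserted at every point of the window
instead of at one point; no printed source places it, and at `t' = 0` it is the contested side of the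
stripe question, cf. the route's own kill criterion K3 and `Literature.Barriers.HubbardSuperconductivity.
PureModelStripeCompetition`). This file records, sorry-free and definition-free, on the literal route terms:

* `diluteDWavePairsCondense_of_strongCouplingWindow` — **`H ⇒ C`** (drop the three hypotheses);
* `hubbardSuperconductivity_of_strongCouplingWindow` — **`H ⇒ S` alone** (instantiate `U := 12 > 0`);
* `strongCouplingWindowAt_of_diluteDWavePairsCondense` — pointwise converse: at every `U` of the
  window where (a), (b), (c) hold, `C` delivers the summit's matrix at `U`;
* `diluteDWavePairsCondense_iff_strongCouplingWindow_of_package` — hence, UNDER THE ROUTE'S OWN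
  PHYSICAL PREMISE that the zero-, one- and two-hole package (a) ∧ (b) ∧ (c) holds throughout the window
  (thesis: "for U in the cuprate-to-strong-coupling window two doped holes BIND into a d-coherent pair";
  cruxes #2, #3 and support `MottGapFromSingleMode` assert it at a witness), **`C ⟺ H`**: the crux is
  the summit asserted at every `U ∈ [12, 24]`;
* `hubbardSuperconductivity_of_diluteDWavePairsCondense_of_packageAt` — `C` plus the package at ONE
  `U` of the window is already the summit (the content of the route's `closes`, with cruxes #2/#3 and
  the Mott-gap support abstracted into their conjunction at a common `U`).

Reading for the tribunal: `C` is sandwiched between `S`-at-every-lit-`U` and `H`; its hypotheses are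
`O(1)`-hole spectral data (sectors `L²`, `L² - 1`, `L² - 2`) while its conclusion lives at hole
density `δ > 0` (sectors `(1 - δ)L²`), and no landed or printed theorem consumes data of the former kind
to produce ground-state long-range order of a non-conserved `U(1)` order parameter (the two strategist
censuses `Cruxes/DiluteDWavePairsCondense/STRATEGY-CENSUS.md`, s1 and r1, enumerate the engines). With
the landed dichotomy `¬ BoundCoherentDWavePairs → C` (`…Dichotomy.lean`, p151329) the truth table is:
`C` is vacuous off the lit set of the window and equals `H` on it. Pure logic; no definition is
introduced; `Literature.Barriers.HubbardSuperconductivity.PureModelStripeCompetition` is deliberately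
NOT imported (route docstring: its open conjectures must not re-enter the cone), so the summit matrix
is written out instead of `HasDWavePairFieldLROAt`. [folklore]
-/

-- the mandated namespace `Summit.<Summit>.<Problem>.Theorems` repeats `HubbardSuperconductivity`
-- (single-problem summit, D-0017), which the `dupNamespace` linter flags on every declaration
set_option linter.dupNamespace false

noncomputable section

namespace Summit.HubbardSuperconductivity.HubbardSuperconductivity.Theorems.ParentFirstSMA

open Matrix Finset Filter
open Literature.Probability.LatticeModels Literature.MathematicalPhysics.QuantumLattice
open Summit.HubbardSuperconductivity.HubbardSuperconductivity.Theses.ParentFirstSMA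

/-- **`H ⇒ C`.** `d`-wave pair-field LRO at some doping for EVERY `U ∈ [12, 24]` (the summit's matrix
asserted on the whole strong-coupling window) implies the BEC-bridge crux outright: its three
hypotheses (a) charge gap, (b) two-hole binding, (c) `d`-coherence are simply dropped. [folklore] -/
theorem diluteDWavePairsCondense_of_strongCouplingWindow
    (h : ∀ U : ℝ, 12 ≤ U → U ≤ 24 → ∃ δ ∈ Set.Ioo (0 : ℝ) (1 / 2),
      ∀ (N : ℕ → ℕ) (ψ : ∀ L, Fock (Orb (FermionTorus 2 L))),
        (∀ L, Even L → N L = 2 * ⌊(1 - δ) * (L : ℝ) ^ 2 / 2⌋₊ ∧ star (ψ L) ⬝ᵥ ψ L = 1 ∧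
            IsGroundStateInSector (hubbardTorus 2 L 1 U) (N L) 0 (ψ L)) →
          HasLongRangeOrder (fun k => halfOpenBox 2 (2 * k))
            (fun k => torusPullback (pairFieldCorr dWaveFormFactor ψ) (2 * k))) :
    Summit.HubbardSuperconductivity.HubbardSuperconductivity.Theses.ParentFirstSMA.DiluteDWavePairsCondense :=
  fun U hU12 hU24 _ _ _ => h U hU12 hU24

/-- **`H ⇒ S` alone.** The same window hypothesis proves the summit with no other input: take
`U := 12 > 0`. Together with `diluteDWavePairsCondense_of_strongCouplingWindow` this is the tribunal's
T1 route (a) for crux `DiluteDWavePairsCondense` (dominating hypothesis implying the summit by itself).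
[folklore] -/
theorem hubbardSuperconductivity_of_strongCouplingWindow
    (h : ∀ U : ℝ, 12 ≤ U → U ≤ 24 → ∃ δ ∈ Set.Ioo (0 : ℝ) (1 / 2),
      ∀ (N : ℕ → ℕ) (ψ : ∀ L, Fock (Orb (FermionTorus 2 L))),
        (∀ L, Even L → N L = 2 * ⌊(1 - δ) * (L : ℝ) ^ 2 / 2⌋₊ ∧ star (ψ L) ⬝ᵥ ψ L = 1 ∧
            IsGroundStateInSector (hubbardTorus 2 L 1 U) (N L) 0 (ψ L)) →
          HasLongRangeOrder (fun k => halfOpenBox 2 (2 * k))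
            (fun k => torusPullback (pairFieldCorr dWaveFormFactor ψ) (2 * k))) :
    _root_.HubbardSuperconductivity := by
  obtain ⟨δ, hδ, hS⟩ := h 12 le_rfl (by norm_num)
  exact ⟨12, by norm_num, δ, hδ, hS⟩

/-- **Pointwise converse on the lit set.** At every `U ∈ [12, 24]` at which the package (a) ∧ (b) ∧ (c)
holds, the crux delivers exactly the summit's matrix at `U` (some `δ ∈ (0, 1/2)` with `d`-wave
pair-field LRO of every admissible ground-state sequence): on the lit set, `C` IS the summit at strong
coupling `U`, pointwise. [folklore] -/
theorem strongCouplingWindowAt_of_diluteDWavePairsCondense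
    (h : Summit.HubbardSuperconductivity.HubbardSuperconductivity.Theses.ParentFirstSMA.DiluteDWavePairsCondense)
    (U : ℝ) (hU12 : 12 ≤ U) (hU24 : U ≤ 24)
    (hA : ∃ g : ℝ, 0 < g ∧ ∃ L₀ : ℕ, ∀ L : ℕ, L₀ ≤ L → Even L →
      g ≤ chargeGap (fermionTorusGraph 2 L) 1 U (L ^ 2))
    (hB : ∃ b : ℝ, 0 < b ∧ ∃ L₀ : ℕ, ∀ L : ℕ, L₀ ≤ L → Even L →
      b ≤ 2 * groundEnergyAt (fermionTorusGraph 2 L) 1 U (L ^ 2 - 1) -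
        groundEnergyAt (fermionTorusGraph 2 L) 1 U (L ^ 2) - groundEnergyAt (fermionTorusGraph 2 L) 1 U (L ^ 2 - 2))
    (hC : ∃ z : ℝ, 0 < z ∧ ∃ L₀ : ℕ, ∀ (L : ℕ) [NeZero L], L₀ ≤ L → Even L →
      ∃ φ₂ ψ₀ : Fock (Orb (FermionTorus 2 L)), IsGroundState (hubbardTorus 2 L 1 U) (L ^ 2 - 2) φ₂ ∧
        star φ₂ ⬝ᵥ φ₂ = 1 ∧ IsGroundState (hubbardTorus 2 L 1 U) (L ^ 2) ψ₀ ∧ star ψ₀ ⬝ᵥ ψ₀ = 1 ∧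
          z * (L : ℝ) ^ 2 ≤ ‖star φ₂ ⬝ᵥ (pairField dWaveFormFactor L *ᵥ ψ₀)‖ ^ 2) :
    ∃ δ ∈ Set.Ioo (0 : ℝ) (1 / 2),
      ∀ (N : ℕ → ℕ) (ψ : ∀ L, Fock (Orb (FermionTorus 2 L))),
        (∀ L, Even L → N L = 2 * ⌊(1 - δ) * (L : ℝ) ^ 2 / 2⌋₊ ∧ star (ψ L) ⬝ᵥ ψ L = 1 ∧
            IsGroundStateInSector (hubbardTorus 2 L 1 U) (N L) 0 (ψ L)) →
          HasLongRangeOrder (fun k => halfOpenBox 2 (2 * k))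
            (fun k => torusPullback (pairFieldCorr dWaveFormFactor ψ) (2 * k)) :=
  h U hU12 hU24 hA hB hC

/-- **Under the route's own premise, `C ⟺ H`.** If the few-body package (a) ∧ (b) ∧ (c) holds at every
`U` of the window `[12, 24]` — which is what the thesis of `ParentFirstSMA` asserts physically ("for U
in the cuprate-to-strong-coupling window two doped holes bind into a d_{x²-y²}-coherent pair" on top of
the Mott gap), and what cruxes #2, #3 with support `MottGapFromSingleMode` certify at a witness — then
the crux is EQUIVALENT to the summit asserted at every `U ∈ [12, 24]`. The hypotheses carry no
information the conclusion could use: they only select on which `U` the summit is owed. [folklore] -/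
theorem diluteDWavePairsCondense_iff_strongCouplingWindow_of_package
    (hPkg : ∀ U : ℝ, 12 ≤ U → U ≤ 24 →
      (∃ g : ℝ, 0 < g ∧ ∃ L₀ : ℕ, ∀ L : ℕ, L₀ ≤ L → Even L →
        g ≤ chargeGap (fermionTorusGraph 2 L) 1 U (L ^ 2)) ∧
      (∃ b : ℝ, 0 < b ∧ ∃ L₀ : ℕ, ∀ L : ℕ, L₀ ≤ L → Even L →
        b ≤ 2 * groundEnergyAt (fermionTorusGraph 2 L) 1 U (L ^ 2 - 1) -
          groundEnergyAt (fermionTorusGraph 2 L) 1 U (L ^ 2) - groundEnergyAt (fermionTorusGraph 2 L) 1 U (L ^ 2 - 2)) ∧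
      (∃ z : ℝ, 0 < z ∧ ∃ L₀ : ℕ, ∀ (L : ℕ) [NeZero L], L₀ ≤ L → Even L →
        ∃ φ₂ ψ₀ : Fock (Orb (FermionTorus 2 L)), IsGroundState (hubbardTorus 2 L 1 U) (L ^ 2 - 2) φ₂ ∧
          star φ₂ ⬝ᵥ φ₂ = 1 ∧ IsGroundState (hubbardTorus 2 L 1 U) (L ^ 2) ψ₀ ∧ star ψ₀ ⬝ᵥ ψ₀ = 1 ∧
            z * (L : ℝ) ^ 2 ≤ ‖star φ₂ ⬝ᵥ (pairField dWaveFormFactor L *ᵥ ψ₀)‖ ^ 2)) :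
    Summit.HubbardSuperconductivity.HubbardSuperconductivity.Theses.ParentFirstSMA.DiluteDWavePairsCondense ↔
      ∀ U : ℝ, 12 ≤ U → U ≤ 24 → ∃ δ ∈ Set.Ioo (0 : ℝ) (1 / 2),
        ∀ (N : ℕ → ℕ) (ψ : ∀ L, Fock (Orb (FermionTorus 2 L))),
          (∀ L, Even L → N L = 2 * ⌊(1 - δ) * (L : ℝ) ^ 2 / 2⌋₊ ∧ star (ψ L) ⬝ᵥ ψ L = 1 ∧
              IsGroundStateInSector (hubbardTorus 2 L 1 U) (N L) 0 (ψ L)) →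
            HasLongRangeOrder (fun k => halfOpenBox 2 (2 * k))
              (fun k => torusPullback (pairFieldCorr dWaveFormFactor ψ) (2 * k)) := by
  refine ⟨fun h U hU12 hU24 => ?_, diluteDWavePairsCondense_of_strongCouplingWindow⟩
  obtain ⟨hA, hB, hC⟩ := hPkg U hU12 hU24
  exact h U hU12 hU24 hA hB hC

/-- **`C` plus the package at ONE point of the window is the summit.** If the crux holds and (a), (b),
(c) hold at some `U ∈ [12, 24]`, then `HubbardSuperconductivity` (`U > 0` since `U ≥ 12`). This is the
content of the route's deciding theorem `closes` with cruxes #2, #3 and the Mott-gap support abstracted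
into their conjunction at a common `U`: modulo the few-body items, `C` is the summit. [folklore] -/
theorem hubbardSuperconductivity_of_diluteDWavePairsCondense_of_packageAt
    (h : Summit.HubbardSuperconductivity.HubbardSuperconductivity.Theses.ParentFirstSMA.DiluteDWavePairsCondense)
    (hPkg : ∃ U : ℝ, 12 ≤ U ∧ U ≤ 24 ∧
      (∃ g : ℝ, 0 < g ∧ ∃ L₀ : ℕ, ∀ L : ℕ, L₀ ≤ L → Even L →
        g ≤ chargeGap (fermionTorusGraph 2 L) 1 U (L ^ 2)) ∧
      (∃ b : ℝ, 0 < b ∧ ∃ L₀ : ℕ, ∀ L : ℕ, L₀ ≤ L → Even L →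
        b ≤ 2 * groundEnergyAt (fermionTorusGraph 2 L) 1 U (L ^ 2 - 1) -
          groundEnergyAt (fermionTorusGraph 2 L) 1 U (L ^ 2) - groundEnergyAt (fermionTorusGraph 2 L) 1 U (L ^ 2 - 2)) ∧
      (∃ z : ℝ, 0 < z ∧ ∃ L₀ : ℕ, ∀ (L : ℕ) [NeZero L], L₀ ≤ L → Even L →
        ∃ φ₂ ψ₀ : Fock (Orb (FermionTorus 2 L)), IsGroundState (hubbardTorus 2 L 1 U) (L ^ 2 - 2) φ₂ ∧
          star φ₂ ⬝ᵥ φ₂ = 1 ∧ IsGroundState (hubbardTorus 2 L 1 U) (L ^ 2) ψ₀ ∧ star ψ₀ ⬝ᵥ ψ₀ = 1 ∧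
            z * (L : ℝ) ^ 2 ≤ ‖star φ₂ ⬝ᵥ (pairField dWaveFormFactor L *ᵥ ψ₀)‖ ^ 2)) :
    _root_.HubbardSuperconductivity := by
  obtain ⟨U, hU12, hU24, hA, hB, hC⟩ := hPkg
  obtain ⟨δ, hδ, hS⟩ := h U hU12 hU24 hA hB hC
  exact ⟨U, by linarith, δ, hδ, hS⟩

end Summit.HubbardSuperconductivity.HubbardSuperconductivity.Theorems.ParentFirstSMA

end
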